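import Mathlib
import Literature.Analysis.Complex.SeveralVariables
import Literature.MathematicalPhysics.QuantumFieldTheory.Balaban1983to89.B11SectG

/-!
# Bałaban, *Renormalization group approach to lattice gauge field theories. I* (CMP 109, 1987), §4 pp. 281–282:
# the bound (4.5) on the functional derivatives, KERNEL-CHECKED from the representation (4.3), the analyticity
# domain (4.4), the sup bound (1.18) and the Sect. G input of [15] — an iterated Cauchy estimate on a polydisc

Source reproduced (statement level + kernel bookkeeping; nothing of the series is asserted):

* T. Bałaban, *Renormalization group approach to lattice gauge field theories. I. Generation of effective actions in
  a small field approximation and a coupling constant renormalization in four dimensions*, Commun. Math. Phys.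
  **109** (1987) 249–301 [`Balaban1987RG1`; renders `b2b-balaban-ref1/pages/1987-cmp109-rg-I-small-field/…-p033-x2.png`,
  `…-p034-x2.png`, `…-p015-x2.png` read for this module].

  p. 281 [PDF 33], verbatim: *"Terms with m < n are exponentially small in L^jη. To see it we write the functional
  derivatives in a form, which will be convenient for other estimates also. Consider a more general expression with
  different functions B₁, …, B_n. Using the gauge transformation in (3.37), and the gauge invariance of the function
  𝐄^{(j)}(X, U), we have  𝐄^{(j)}(X, U_j(□₀, exp iB)) = 𝐄^{(j)}(X, exp iξ𝐇_j(□₀, B)).  (4.2)  Differentiating the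
  composite function on the right-hand side above n times with respect to B, we obtain the identities
  ⟨δⁿ/δBⁿ 𝐄^{(j)}(X, U_j(□₀, 1)), ⊗_{i=1}^n B_i⟩
   = Σ_{{1,…,n}=N(1)∪…∪N(r)} ⟨δʳ/δ𝐇ʳ 𝐄^{(j)}(X, 1), ⊗_{p=1}^r ⟨δ^{n(p)}/δB^{n(p)} 𝐇_j(□₀, 0), ⊗_{i∈N(p)} B_i⟩⟩
   = Σ ∂ʳ/(∂τ₁…∂τ_r) 𝐄^{(j)}(X, exp iξ Σ_{p=1}^r τ_p ⟨δ^{n(p)}/δB^{n(p)} 𝐇_j(□₀, 0), ⊗_{i∈N(p)} B_i⟩)|_{τ=0}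
   = Σ Π_{p=1}^r (1/2πi) ∮ dτ_p/τ_p² 𝐄^{(j)}(X, exp iξ Σ_{p=1}^r τ_p ⟨δ^{n(p)}/δB^{n(p)} 𝐇_j(□₀, 0), ⊗_{i∈N(p)} B_i⟩).  (4.3)
  Now, let us recall the considerations connected with the function (3.13). We have noticed there that this function
  is analytic on the corresponding spaces of variables 𝐔, 𝐉, 𝐀, and this fact is quite general, valid for an
  arbitrary domain X. In the last formula above we have the function 𝐄^{(j)}(X, exp iξ𝐀), i.e. the function with
  𝐔 = 1, 𝐉 = 0. Thus it is defined and analytic on the space of configurations 𝐀 satisfying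
  max{|𝐀|_X, |P₁(□₀)𝐀|_X, |∇^ξ𝐀|_X, |Δ^ξ𝐀|_X} < α₂.  (4.4)"*

  p. 282 [PDF 34], verbatim: *"The functional derivative (δ^{n(p)})/(δB^{n(p)})𝐇_j(□₀, 0) is given by a sum of several
  perturbative expressions discussed in Sect. G [15]. Each expression corresponds to a tree graph with n(p) initial
  points and one final point, and it has an exponential decay in a length of this graph. The derivative has an
  exponential decay in a length of a shortest tree graph of this type. The norm in (4.4) of the expression
  ⟨δ^{n(p)}/δB^{n(p)} 𝐇_j(□₀, 0), ⊗_{i∈N(p)} B_i⟩ can be estimated by B₃ Π_{i∈N(p)} |B_i|, and if one of the functions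
  B_i is localized outside the domain X, then we have the additional exponential factor
  exp(−δ₀ dist^{(ξ)}(X, supp B_i)). Consider a term in (4.1) with m < n. Using (4.3) and the last remarks we obtain
  |⟨δⁿ/δBⁿ 𝐄^{(j)}(X, U_j(□₀, 1)), (⊗^m ζ̃_□B) ⊗ (⊗^{n−m} (1−ζ̃_□)B)⟩|
   ≤ (2n²B₃ (1/α₂))ⁿ E₀ exp(−κd_j(X)) exp(−δ₀ dist^{(ξ)}(X, supp(1−ζ̃_□))) × |ζ̃_□B|^m |(1−ζ̃_□)B|^{n−m}.  (4.5)
  The distance in the second exponential is bounded from below by M(L^jη)^{−1}, hence we get the exponential factor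
  exp(−δ₀M(L^jη)^{−1}). This implies that the terms in (4.1) with m < n are irrelevant."*

  p. 263 [PDF 15], verbatim: *"We assume that the function 𝐄^{(j)}(X, g_{j−1}, 𝐔, 𝐉) is defined and analytic on the
  space U^c_j(X, α₀, α₁), with some positive, absolute constants α₀, α₁ … There exists a constant E₀ such that
  |𝐄^{(j)}(X, g_{j−1}, 𝐔, 𝐉)| ≤ E₀ exp(−κd_j(X))  (1.18)  for M ≥ M(κ), γ sufficiently small, and for all
  configurations (𝐔, 𝐉) ∈ U^c_j(X, α₀, α₁)."*

* T. Bałaban, *The variational problem and background fields in renormalization group method for lattice gauge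
  theories*, Commun. Math. Phys. **102** (1985) 277–309 [`Balaban1985Variational`] = [15] of [I]: Sect. G (190)
  p. 308, in the tree as `B11SectG.Ineq190` (a block majorant `C e^{−⅛δ₀d(y,y′)}` of `(δ/δB)𝓗`), and T. Bałaban,
  *Propagators and renormalization transformations for lattice gauge theories. II*, Commun. Math. Phys. **96** (1984)
  223–250 [`Balaban1984PropagatorsII`] = [3] of [15]: Lemma 2.1 (2.61) p. 234, in the tree as `B11SectG.RowSum`.

WHAT THIS MODULE DOES (surge unit `b2b-balaban-pv12`, gen 2, node `G-IF-07-KERNEL`, 2026-08-18; imports `Mathlib`,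
`Literature.Analysis.Complex.SeveralVariables` (one-variable Cauchy estimate for a directional derivative,
holomorphy of directional derivatives — any complex normed domain) and `…Balaban1983to89.B11SectG`; modifies nothing;
cell rows GAPS G-IF-07 / G-IF-06 (b11-g2), GAPS C-pv12-4, DIVERGENCE D-pv12.3–5, SMALLNESS S-B12.17, GAPS G-pv12-2):

1. `dirIter r v f` — the iterated directional derivative `∂_{v_r} ⋯ ∂_{v_1} f` of a map `f : E → F` between complex
   normed spaces (`E` = the configurations 𝐀 with the norm (4.4), `f = 𝐀 ↦ 𝐄^{(j)}(X, exp iξ𝐀)`, `v_p` = the `r`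
   insertions `⟨δ^{n(p)}/δB^{n(p)} 𝐇_j(□₀,0), ⊗_{i∈N(p)} B_i⟩` of one partition in (4.3)); `dirIter_succ_eqOn_slice`:
   on the domain of holomorphy each step is the `τ`-derivative at `0` of the complex-line slice — the second member of
   (4.3); `polydisc x v ρ = {x + Σ_p τ_p v_p : |τ_p| ≤ ρ_p}`.
2. KERNEL (generic, not in Mathlib): `norm_dirIter_le` — `f` holomorphic on an open `U ⊇ polydisc x v ρ`, `‖f‖ ≤ S`
   on the polydisc ⇒ `‖dirIter r v f x‖ ≤ S / Π_p ρ_p` (induction: Cauchy's estimate on the circle `|τ_1| = ρ_1`, then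
   the same for `∂_{v_1} f`, holomorphic on `U`); `norm_dirIter_le_of_ball(')` — with `U ⊇ {‖𝐀‖ < α}`, `‖f‖ ≤ S`
   there and `‖v_p‖ ≤ β_p`, the radii `ρ_p = α/(2rβ_p)` (polydisc inside `‖𝐀‖ ≤ α/2`) give
   `‖dirIter r v f 0‖ ≤ S (2r/α)^r Π_p β_p` (a block with `β_p = 0` contributes `0`: `dirIter_eq_zero_of_exists_eq_zero`).
3. `term_bound` — ONE TERM OF (4.3) BOUNDED AS IN (4.5): blocks `N(p)` of a partition of the arguments, sizes
   `|B_i| = b_i ≥ 0`, the p. 282 bounds `‖v_p‖ ≤ w_p · B₃ Π_{i∈N(p)} b_i` with localisation weights `w_p ∈ [0,1]` ⇒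
   `‖term‖ ≤ S (2rB₃/α₂)^r · w_{p₀} · Π_i b_i` for ANY ONE block `p₀` (`prod_weights_le_single`: keeping a single
   localisation factor, as (4.5) does, is an upper bound — cell GAPS G-IF-07 (ii)); `term_bound_pair`: two
   localised arguments in DIFFERENT blocks keep BOTH weights `w_{p₀} w_{p₁}` — the bound displayed on p. 286 [PDF 38]
   before (4.22), verbatim *"the points x, x₃ are connected with different sets in a partition, and we apply the
   identities (4.3) with localizations at the points x, x₃ fixed … Σ_{x,x₃} (8B₃ (1/α₂))⁴ E₀ exp(−κd_j(X) −
   δ₀dist^{(ξ)}(X, x) − δ₀dist^{(ξ)}(X, x₃)) |B|² |δB(x)| |(∂B)(Γ_{x,x₃})|"* (render `…-p038-x2.png`);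
   `card_blocks_le`: `r ≤ n`.
4. `card_finpartitions_le` — the index set of (4.3): set partitions of an `n`-set number `≤ nⁿ` (Bell(n) ≤ nⁿ, by
   the injection block ↦ least element, `label_injective`).
5. `sum_bound` / `sum_bound_partitions` — THE PRINTED CONSTANT: `≤ nⁿ` terms, each `≤ S (2rB₃/α₂)^r W P` with
   `1 ≤ r ≤ n`, and `2B₃ ≥ α₂` ⇒ `‖Σ‖ ≤ (2n²B₃/α₂)ⁿ S W P`; `Ineq45Printed` = the display (4.5) typed over the printed
   numbers (`Data45`), and `ineq45_of_repr43 : … → Ineq45Printed D` — (4.5) from: lhs = |Σ_Q term Q| ((4.3)),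
   the per-term bounds (item 3 with `S = E₀e^{−κd_j(X)}` from (1.18) on the domain (4.4), `W = e^{−δ₀dist^{(ξ)}(X,
   supp(1−ζ̃_□))}`, `P = |ζ̃_□B|^m|(1−ζ̃_□)B|^{n−m}` = `prod_two_kinds`), `n ≥ 1`, `2B₃ ≥ α₂`.  Every real input is a
   named hypothesis; the module asserts nothing about 𝐄^{(j)}, 𝐇_j.
6. `loc_dH_le_of_ineq190(_localised)` — the p. 282 sentence for the blocks with `n(p) = 1` FROM THE TREE'S (190):
   `B11SectG.Ineq190` + `HasMaj.bound` + one `RowSum` at rate `σ` ⇒ `loc_y((δ/δB)𝓗 B) ≤ C κ_B c(σ) · |B|` for all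
   blocks `y`, and `≤ C κ_B c(σ) |B| e^{−τD}` for `y ∈ X` when the block sizes of `B` vanish within distance `D` of `X`,
   for every `τ ≥ 0` with `τ + σ ≤ ⅛δ₀^{[15]}`.  This makes cell GAPS G-IF-06 quantitative: `B₃ = Cκ_B c(σ)` and the
   rate called `δ₀` in [I] §4 is `τ ≤ ⅛δ₀^{[15]} − σ`, STRICTLY below `⅛δ₀^{[15]}` by the row-sum margin (recorded in
   cell SMALLNESS.md; downstream only a positive rate is consumed).

WHAT IS *NOT* HERE: the identities (4.2)–(4.3) themselves (gauge invariance + the chain rule for 𝐄^{(j)} ∘ exp iξ𝐇_j —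
the left-hand side of (4.5) enters only through the hypothesis `hlhs : lhs = ‖Σ_Q term Q‖`); the analyticity of
𝐄^{(j)}(X, exp iξ·) on (4.4) and the bound (1.18) there (hypotheses `hf`, `hball`, `hS`; B12 p. 281 refers them to
*"the considerations connected with the function (3.13)"*); the p. 282 bounds for blocks with `n(p) ≥ 2` (tree-graph
expansions of Sect. G [15] for higher variational derivatives — not typed in `B11SectG`, cell GAPS G-B11-G2a; they are
the hypothesis `hv` of `term_bound`) — in particular the FIRST case of p. 286, *"In the first the points x, x₃
are connected with the same set N(p) in (4.3). Then the exponential factor, with a length of a shortest tree graph in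
the exponent, yields the factor exp(−δ₀|x₃ − x|)"*, and the remark *"we can bound the derivative 𝐄^{(n)}(X, x₁, …,
x_n) by a constant times the exponential exp(−O(1)κd_j(X∪{x₁, …, x_n}))"* (intra-block tree decay: several localised
arguments in ONE block); the identification of the (4.4)-norm of a configuration with a maximum of block
sizes (item 6 is stated per local size `bout`, one entry of (190) at a time); the words *"terms in (4.1) with m < n are
irrelevant"* (the lower bound `dist ≥ M(L^jη)^{−1}` and the bookkeeping of (0.28) — cell GAPS G-IF-07 closing note).
Value = kernel-checked derivation of a located by-reference step (Cauchy on a polydisc + counting) modulo named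
printed leaves + typed display, NOT summit progress.
-/

noncomputable section

open Set Metric Filter Finset
open scoped Topology BigOperators

namespace Literature.MathematicalPhysics.QuantumFieldTheory.Balaban1983to89.B12Ineq45

open Literature.Analysis.Complex

section Generic

variable {E : Type*} [NormedAddCommGroup E] [NormedSpace ℂ E]
  {F : Type*} [NormedAddCommGroup F] [NormedSpace ℂ F]

/-- Iterated directional derivative `∂_{v (r-1)} ⋯ ∂_{v 1} ∂_{v 0} f` (differentiate first along `v 0`) — the
`r`-fold `τ`-derivative at `0` in the second member of (4.3) (`dirIter_succ_eqOn_slice`). [folklore] -/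
def dirIter : (r : ℕ) → (Fin r → E) → (E → F) → E → F
  | 0, _, f => f
  | r + 1, v, f => dirIter r (Fin.tail v) fun y => fderiv ℂ f y (v 0)

/-- No direction: `dirIter 0 v f = f`. [folklore] -/
@[simp] theorem dirIter_zero (v : Fin 0 → E) (f : E → F) : dirIter 0 v f = f := rfl

/-- One more direction: differentiate along `v 0` first, then iterate along the tail. [folklore] -/
theorem dirIter_succ {r : ℕ} (v : Fin (r + 1) → E) (f : E → F) :
    dirIter (r + 1) v f = dirIter r (Fin.tail v) (fun y => fderiv ℂ f y (v 0)) := rfl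

/-- The iterated directional derivative of the zero map is zero. [folklore] -/
theorem dirIter_const_zero : ∀ (r : ℕ) (v : Fin r → E),
    dirIter r v (fun _ : E => (0 : F)) = fun _ => 0
  | 0, _ => rfl
  | r + 1, v => by
    rw [dirIter_succ]
    have h : (fun y : E => fderiv ℂ (fun _ : E => (0 : F)) y (v 0)) = fun _ => 0 := by
      funext y; simp
    rw [h]
    exact dirIter_const_zero r (Fin.tail v)

/-- A zero direction kills the iterated directional derivative (a block whose insertion vanishes contributes
nothing to (4.3)). [folklore] -/
theorem dirIter_eq_zero_of_exists_eq_zero : ∀ (r : ℕ) (v : Fin r → E) (f : E → F),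
    (∃ p, v p = 0) → dirIter r v f = fun _ => 0
  | 0, _, _, ⟨p, _⟩ => p.elim0
  | r + 1, v, f, ⟨p, hp⟩ => by
    rw [dirIter_succ]
    by_cases h0 : v 0 = 0
    · have h : (fun y : E => fderiv ℂ f y (v 0)) = fun _ => 0 := by
        funext y; simp [h0]
      rw [h]
      exact dirIter_const_zero r _
    · have hp0 : p ≠ 0 := fun h => h0 (h ▸ hp)
      obtain ⟨q, rfl⟩ := Fin.exists_succ_eq_of_ne_zero hp0
      exact dirIter_eq_zero_of_exists_eq_zero r (Fin.tail v) _ ⟨q, hp⟩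

/-- The closed polydisc spanned by the directions `v` with radii `ρ` at the base point `x`:
`{x + Σ_p τ_p • v_p : |τ_p| ≤ ρ_p}` — the range of the contour variables `τ_p` of the third member of (4.3). [folklore] -/
def polydisc {r : ℕ} (x : E) (v : Fin r → E) (ρ : Fin r → ℝ) : Set E :=
  {y | ∃ τ : Fin r → ℂ, (∀ p, ‖τ p‖ ≤ ρ p) ∧ y = x + ∑ p, τ p • v p}

/-- The base point lies in its polydisc (`τ = 0`). [folklore] -/
theorem mem_polydisc_self {r : ℕ} (x : E) (v : Fin r → E) {ρ : Fin r → ℝ} (hρ : ∀ p, 0 ≤ ρ p) :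
    x ∈ polydisc x v ρ :=
  ⟨fun _ => 0, fun p => by simpa using hρ p, by simp⟩

/-- Moving along the first direction from a point of the tail polydisc stays in the full polydisc. [folklore] -/
theorem add_smul_mem_polydisc {r : ℕ} {x : E} {v : Fin (r + 1) → E} {ρ : Fin (r + 1) → ℝ} {y : E}
    (hy : y ∈ polydisc x (Fin.tail v) (Fin.tail ρ)) {s : ℂ} (hs : ‖s‖ ≤ ρ 0) :
    y + s • v 0 ∈ polydisc x v ρ := by
  obtain ⟨τ, hτ, rfl⟩ := hy
  refine ⟨Fin.cons s τ, fun p => ?_, ?_⟩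
  · refine Fin.cases ?_ (fun q => ?_) p
    · simpa using hs
    · simp only [Fin.cons_succ]
      exact hτ q
  · simp only [Fin.sum_univ_succ, Fin.cons_zero, Fin.cons_succ, Fin.tail]
    abel

/-- The tail polydisc (first contour variable frozen at `0`) lies in the full one. [folklore] -/
theorem polydisc_tail_subset {r : ℕ} {x : E} {v : Fin (r + 1) → E} {ρ : Fin (r + 1) → ℝ}
    (hρ : 0 ≤ ρ 0) : polydisc x (Fin.tail v) (Fin.tail ρ) ⊆ polydisc x v ρ := by
  intro y hy
  simpa using add_smul_mem_polydisc hy (s := 0) (by simpa using hρ)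

/-- Points of the polydisc are within `Σ_p ρ_p ‖v_p‖` of the base point. [folklore] -/
theorem norm_sub_le_of_mem_polydisc {r : ℕ} {x : E} {v : Fin r → E} {ρ : Fin r → ℝ} {y : E}
    (hy : y ∈ polydisc x v ρ) : ‖y - x‖ ≤ ∑ p, ρ p * ‖v p‖ := by
  obtain ⟨τ, hτ, rfl⟩ := hy
  rw [add_sub_cancel_left]
  refine (norm_sum_le _ _).trans (Finset.sum_le_sum fun p _ => ?_)
  rw [norm_smul]
  exact mul_le_mul_of_nonneg_right (hτ p) (norm_nonneg _)

/-- Iterated directional derivatives only see the function on the open set where they are evaluated. [folklore] -/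
theorem dirIter_congr_eqOn {U : Set E} (hU : IsOpen U) : ∀ (r : ℕ) (v : Fin r → E) (f f' : E → F),
    EqOn f f' U → EqOn (dirIter r v f) (dirIter r v f') U
  | 0, _, _, _, h => h
  | r + 1, v, f, f', h => by
    rw [dirIter_succ, dirIter_succ]
    refine dirIter_congr_eqOn hU r (Fin.tail v) _ _ fun y hy => ?_
    have hff' : f =ᶠ[𝓝 y] f' := h.eventuallyEq_of_mem (hU.mem_nhds hy)
    simp only [hff'.fderiv_eq]

/-- **Line 2 of (4.3)**: on the open set of differentiability, one step of `dirIter` IS the `τ`-derivative at `τ = 0`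
of the complex-line slice `τ ↦ f(y + τ v₀)` — so `dirIter r v f 0 = ∂ʳ/∂τ₁…∂τ_r f(Σ_p τ_p v_p)|_{τ=0}` computed one
variable at a time, the object of the second member of (4.3). [cite: Balaban1987RG1, (4.3) p.281] -/
theorem dirIter_succ_eqOn_slice {U : Set E} (hU : IsOpen U) {f : E → F} (hf : DifferentiableOn ℂ f U) {r : ℕ}
    (v : Fin (r + 1) → E) :
    EqOn (dirIter (r + 1) v f)
      (dirIter r (Fin.tail v) fun y => deriv (fun t : ℂ => f (y + t • v 0)) 0) U := by
  rw [dirIter_succ]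
  refine dirIter_congr_eqOn hU r (Fin.tail v) _ _ fun y hy => ?_
  exact ((SCV.hasDerivAt_slice_zero (hf.differentiableAt (hU.mem_nhds hy)) (v 0)).deriv).symm

variable [CompleteSpace F]

/-- **Iterated Cauchy estimate on a polydisc** (the engine of (4.3) ⇒ (4.5); line 3 of (4.3) is the `r`-fold
contour formula behind it): `f` holomorphic on an open `U` containing the closed polydisc `{x + Σ_p τ_p v_p : |τ_p| ≤
ρ_p}` and bounded by `S` on it ⇒ `‖∂_{v_r} ⋯ ∂_{v_1} f(x)‖ ≤ S / Π_p ρ_p`.  Induction on `r`: `∂_{v_1} f` is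
holomorphic on `U` (`SCV.differentiableOn_fderiv_apply`, differentiation under the Cauchy integral) and bounded by
`S/ρ_1` on the tail polydisc (`SCV.norm_fderiv_apply_le`, the one-variable Cauchy estimate on the circle
`|τ_1| = ρ_1`).  Any complex normed `E`, complete `F`; not in Mathlib. [folklore] -/
theorem norm_dirIter_le {U : Set E} (hU : IsOpen U) :
    ∀ (r : ℕ) (f : E → F), DifferentiableOn ℂ f U →
      ∀ (x : E) (v : Fin r → E) (ρ : Fin r → ℝ), (∀ p, 0 < ρ p) → ∀ (S : ℝ),
        polydisc x v ρ ⊆ U → (∀ y ∈ polydisc x v ρ, ‖f y‖ ≤ S) →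
        ‖dirIter r v f x‖ ≤ S / ∏ p, ρ p := by
  intro r
  induction r with
  | zero =>
    intro f _ x v ρ hρ S _ hS
    rw [Fin.prod_univ_zero, div_one, dirIter_zero]
    exact hS x (mem_polydisc_self x v fun p => (hρ p).le)
  | succ r ih =>
    intro f hf x v ρ hρ S hsub hS
    rw [dirIter_succ, Fin.prod_univ_succ, ← div_div]
    set g : E → F := fun y => fderiv ℂ f y (v 0) with hg
    have hgU : DifferentiableOn ℂ g U := SCV.differentiableOn_fderiv_apply hf hU (v 0)
    have hsub' : polydisc x (Fin.tail v) (Fin.tail ρ) ⊆ U :=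
      (polydisc_tail_subset (hρ 0).le).trans hsub
    have hS' : ∀ y ∈ polydisc x (Fin.tail v) (Fin.tail ρ), ‖g y‖ ≤ S / ρ 0 := by
      intro y hy
      refine SCV.norm_fderiv_apply_le hf hU (hρ 0) (fun s hs => hsub (add_smul_mem_polydisc hy ?_))
        (fun s hs => hS _ (add_smul_mem_polydisc hy ?_))
      · simpa using hs
      · simp only [mem_sphere_iff_norm, sub_zero] at hs
        exact hs.le
    exact ih g hgU x (Fin.tail v) (Fin.tail ρ) (fun p => hρ p.succ) (S / ρ 0) hsub' hS'

/-- **Iterated Cauchy estimate from a ball of analyticity** with the radii of B12 p. 282: if `U ⊇ ball 0 α`,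
`‖f‖ ≤ S` on `ball 0 α` and `‖v_p‖ ≤ β_p` (`β_p > 0`), the radii `ρ_p = α/(2rβ_p)` give
`‖∂_{v_{r}} ⋯ ∂_{v_1} f (0)‖ ≤ S · Π_p (2 r β_p / α)` — the factor `(2r·/α₂)` per contour of (4.5).
[cite: Balaban1987RG1, (4.3)–(4.5) pp.281–282] -/
theorem norm_dirIter_le_of_ball {U : Set E} (hU : IsOpen U) {α S : ℝ} (hα : 0 < α)
    (hball : ball (0 : E) α ⊆ U) {f : E → F} (hf : DifferentiableOn ℂ f U)
    (hS : ∀ y ∈ ball (0 : E) α, ‖f y‖ ≤ S) {r : ℕ} (v : Fin r → E) (β : Fin r → ℝ)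
    (hβ : ∀ p, 0 < β p) (hv : ∀ p, ‖v p‖ ≤ β p) :
    ‖dirIter r v f 0‖ ≤ S * ∏ p, (2 * r * β p / α) := by
  set ρ : Fin r → ℝ := fun p => α / (2 * r * β p) with hρdef
  have hrpos : ∀ p : Fin r, (0 : ℝ) < r := fun p => by exact_mod_cast Fin.pos p
  have hρ : ∀ p, 0 < ρ p := fun p => by
    simp only [hρdef]
    exact div_pos hα (by nlinarith [hrpos p, hβ p])
  -- the polydisc sits inside the closed ball of radius α/2, hence inside `ball 0 α ⊆ U`
  have hpoly : polydisc (0 : E) v ρ ⊆ ball (0 : E) α := by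
    intro y hy
    have h1 := norm_sub_le_of_mem_polydisc hy
    rw [sub_zero] at h1
    have h2 : ∑ p, ρ p * ‖v p‖ ≤ ∑ p : Fin r, α / (2 * r) := by
      refine Finset.sum_le_sum fun p _ => ?_
      calc ρ p * ‖v p‖ ≤ ρ p * β p := mul_le_mul_of_nonneg_left (hv p) (hρ p).le
        _ = α / (2 * r) := by
          have hβp : β p ≠ 0 := (hβ p).ne'
          have hr : (r : ℝ) ≠ 0 := (hrpos p).ne'
          simp only [hρdef]
          field_simp
    rw [Finset.sum_const, Finset.card_univ, Fintype.card_fin, nsmul_eq_mul] at h2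
    rw [mem_ball_zero_iff]
    rcases Nat.eq_zero_or_pos r with hr0 | hr0
    · subst hr0
      simp at h1
      simp [h1, hα]
    · have : (r : ℝ) * (α / (2 * r)) = α / 2 := by
        have : (r : ℝ) ≠ 0 := by exact_mod_cast hr0.ne'
        field_simp
      linarith
  have key := norm_dirIter_le hU r f hf 0 v ρ hρ S (hpoly.trans hball) (fun y hy => hS y (hpoly hy))
  refine key.trans (le_of_eq ?_)
  rw [div_eq_mul_inv, ← Finset.prod_inv_distrib]
  congr 1
  refine Finset.prod_congr rfl fun p _ => ?_
  simp only [hρdef, inv_div]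

/-- Same, with the product split: `S · (2r/α)^r · Π_p β_p`, and `β_p ≥ 0` allowed (a block with `β_p = 0` has
`v_p = 0` and the derivative vanishes). [cite: Balaban1987RG1, (4.3)–(4.5) pp.281–282] -/
theorem norm_dirIter_le_of_ball' {U : Set E} (hU : IsOpen U) {α S : ℝ} (hα : 0 < α)
    (hball : ball (0 : E) α ⊆ U) {f : E → F} (hf : DifferentiableOn ℂ f U)
    (hS : ∀ y ∈ ball (0 : E) α, ‖f y‖ ≤ S) {r : ℕ} (v : Fin r → E) (β : Fin r → ℝ)
    (hβ : ∀ p, 0 ≤ β p) (hv : ∀ p, ‖v p‖ ≤ β p) :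
    ‖dirIter r v f 0‖ ≤ S * (2 * r / α) ^ r * ∏ p, β p := by
  have hS0 : 0 ≤ S := (norm_nonneg _).trans (hS 0 (mem_ball_self hα))
  by_cases hz : ∃ p, β p = 0
  · obtain ⟨p, hp⟩ := hz
    have hvp : v p = 0 := by
      have := hv p; rw [hp] at this; exact norm_le_zero_iff.mp this
    rw [dirIter_eq_zero_of_exists_eq_zero r v f ⟨p, hvp⟩]
    simp only [norm_zero]
    exact mul_nonneg (mul_nonneg hS0 (pow_nonneg (by positivity) _)) (Finset.prod_nonneg fun q _ => hβ q)
  · have hβ' : ∀ p, 0 < β p := fun p => lt_of_le_of_ne (hβ p) fun h => hz ⟨p, h.symm⟩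
    refine (norm_dirIter_le_of_ball hU hα hball hf hS v β hβ' hv).trans (le_of_eq ?_)
    rw [mul_assoc]
    congr 1
    rw [Finset.prod_div_distrib, Finset.prod_mul_distrib, Finset.prod_const, Finset.card_univ,
      Fintype.card_fin, Finset.prod_const, Finset.card_univ, Fintype.card_fin]
    rw [div_eq_mul_inv, mul_pow, ← div_eq_mul_inv]
    ring

end Generic

/-! ## Blocks of a partition, the single localisation factor, and the per-term bound of (4.5) -/

section Blocks

variable {E : Type*} [NormedAddCommGroup E] [NormedSpace ℂ E]
  {F : Type*} [NormedAddCommGroup F] [NormedSpace ℂ F] [CompleteSpace F]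
  {ι : Type*} [Fintype ι] [DecidableEq ι]

/-- Keeping ONE localisation weight: `Π_p w_p ≤ w_{p₀}` for weights in `[0, 1]`. [folklore] -/
theorem prod_weights_le_single {r : ℕ} (w : Fin r → ℝ) (h0 : ∀ p, 0 ≤ w p) (h1 : ∀ p, w p ≤ 1)
    (p₀ : Fin r) : ∏ p, w p ≤ w p₀ := by
  rw [← Finset.mul_prod_erase Finset.univ w (Finset.mem_univ p₀)]
  exact mul_le_of_le_one_right (h0 p₀) (Finset.prod_le_one (fun p _ => h0 p) fun p _ => h1 p)

/-- The blocks `N(1), …, N(r)` of a partition of the index set: `Π_p Π_{i∈N(p)} b_i = Π_i b_i`. [folklore] -/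
theorem prod_blocks_eq {r : ℕ} (N : Fin r → Finset ι) (hdisj : ∀ p q, p ≠ q → Disjoint (N p) (N q))
    (hcov : Finset.univ.biUnion N = Finset.univ) (b : ι → ℝ) :
    ∏ p, ∏ i ∈ N p, b i = ∏ i, b i := by
  rw [← Finset.prod_biUnion (by intro p _ q _ hpq; exact hdisj p q hpq), hcov]

/-- Non-empty blocks of a partition of an `n`-set number at most `n`. [folklore] -/
theorem card_blocks_le {r : ℕ} (N : Fin r → Finset ι) (hdisj : ∀ p q, p ≠ q → Disjoint (N p) (N q))
    (hcov : Finset.univ.biUnion N = Finset.univ) (hne : ∀ p, (N p).Nonempty) :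
    r ≤ Fintype.card ι := by
  have h := Finset.card_biUnion (s := Finset.univ) (t := N) (by intro p _ q _ hpq; exact hdisj p q hpq)
  rw [hcov, Finset.card_univ] at h
  calc r = ∑ _p : Fin r, 1 := by simp
    _ ≤ ∑ p : Fin r, (N p).card := Finset.sum_le_sum fun p _ => (hne p).card_pos
    _ = Fintype.card ι := h.symm

/-- **One term of (4.3), bounded as in (4.5).**  `f` = `A ↦ 𝐄^{(j)}(X, exp iξA)`, holomorphic on an open `U`
containing the ball `‖A‖ < α₂` of the (4.4)-norm, with `‖f‖ ≤ S` there (`S = E₀ exp(−κ d_j(X))`, (1.18)); the `r`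
directions `v_p = ⟨δ^{n(p)}/δB^{n(p)} 𝐇_j(□₀,0), ⊗_{i∈N(p)} B_i⟩` over the blocks `N(p)` of a partition of the `B_i`,
with the p. 282 bounds `‖v_p‖ ≤ w_p · B₃ Π_{i∈N(p)} |B_i|`, `w_p ∈ [0,1]` the localisation weight of the block
(`exp(−δ₀ dist(X, supp B_i))` if an outside-localised `B_i` lies in `N(p)`, else `1`).  Conclusion: the term
`∂ʳ/∂τ₁…∂τ_r f(Σ_p τ_p v_p)|_{τ=0}` is at most `S · (2rB₃/α₂)^r · w_{p₀} · Π_i |B_i|` for ANY single block `p₀` —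
one localisation factor, as printed in (4.5). [cite: Balaban1987RG1, (4.3)–(4.5) pp.281–282] -/
theorem term_bound {U : Set E} (hU : IsOpen U) {α₂ S B₃ : ℝ} (hα : 0 < α₂) (hball : ball (0 : E) α₂ ⊆ U)
    {f : E → F} (hf : DifferentiableOn ℂ f U) (hS : ∀ y ∈ ball (0 : E) α₂, ‖f y‖ ≤ S) (hB₃ : 0 ≤ B₃)
    {r : ℕ} (N : Fin r → Finset ι) (hdisj : ∀ p q, p ≠ q → Disjoint (N p) (N q))
    (hcov : Finset.univ.biUnion N = Finset.univ) (b : ι → ℝ) (hb : ∀ i, 0 ≤ b i)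
    (w : Fin r → ℝ) (hw0 : ∀ p, 0 ≤ w p) (hw1 : ∀ p, w p ≤ 1)
    (v : Fin r → E) (hv : ∀ p, ‖v p‖ ≤ w p * (B₃ * ∏ i ∈ N p, b i)) (p₀ : Fin r) :
    ‖dirIter r v f 0‖ ≤ S * (2 * r * B₃ / α₂) ^ r * w p₀ * ∏ i, b i := by
  have hS0 : 0 ≤ S := (norm_nonneg _).trans (hS 0 (mem_ball_self hα))
  set β : Fin r → ℝ := fun p => w p * (B₃ * ∏ i ∈ N p, b i) with hβdef
  have hβ : ∀ p, 0 ≤ β p := fun p =>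
    mul_nonneg (hw0 p) (mul_nonneg hB₃ (Finset.prod_nonneg fun i _ => hb i))
  have h1 := norm_dirIter_le_of_ball' hU hα hball hf hS v β hβ hv
  have h2 : ∏ p, β p = (∏ p, w p) * (B₃ ^ r * ∏ i, b i) := by
    simp only [hβdef]
    rw [Finset.prod_mul_distrib, Finset.prod_mul_distrib, Finset.prod_const, Finset.card_univ,
      Fintype.card_fin, prod_blocks_eq N hdisj hcov b]
  have hP : 0 ≤ B₃ ^ r * ∏ i, b i := mul_nonneg (pow_nonneg hB₃ _) (Finset.prod_nonneg fun i _ => hb i)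
  have h3 : (∏ p, w p) * (B₃ ^ r * ∏ i, b i) ≤ w p₀ * (B₃ ^ r * ∏ i, b i) :=
    mul_le_mul_of_nonneg_right (prod_weights_le_single w hw0 hw1 p₀) hP
  have h4 : (2 * (r : ℝ) * B₃ / α₂) ^ r = (2 * r / α₂) ^ r * B₃ ^ r := by
    rw [← mul_pow]; congr 1; ring
  calc ‖dirIter r v f 0‖ ≤ S * (2 * r / α₂) ^ r * ∏ p, β p := h1
    _ = S * (2 * r / α₂) ^ r * ((∏ p, w p) * (B₃ ^ r * ∏ i, b i)) := by rw [h2]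
    _ ≤ S * (2 * r / α₂) ^ r * (w p₀ * (B₃ ^ r * ∏ i, b i)) :=
      mul_le_mul_of_nonneg_left h3 (mul_nonneg hS0 (pow_nonneg (by positivity) _))
    _ = S * (2 * r * B₃ / α₂) ^ r * w p₀ * ∏ i, b i := by rw [h4]; ring

/-- Keeping TWO block weights is also an upper bound for the product of all of them (weights in `[0,1]`).
[folklore] -/
theorem prod_weights_le_pair {r : ℕ} (w : Fin r → ℝ) (h0 : ∀ p, 0 ≤ w p) (h1 : ∀ p, w p ≤ 1)
    {p₀ p₁ : Fin r} (hne : p₀ ≠ p₁) : ∏ p, w p ≤ w p₀ * w p₁ := by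
  rw [← Finset.mul_prod_erase Finset.univ w (Finset.mem_univ p₀)]
  have hmem : p₁ ∈ Finset.univ.erase p₀ := Finset.mem_erase.2 ⟨hne.symm, Finset.mem_univ _⟩
  rw [← Finset.mul_prod_erase _ w hmem]
  refine mul_le_mul_of_nonneg_left ?_ (h0 p₀)
  exact mul_le_of_le_one_right (h0 p₁) (Finset.prod_le_one (fun p _ => h0 p) fun p _ => h1 p)

/-- **The two-factor case of p. 286** (the bound displayed before (4.22): *"the points x, x₃ are connected with
different sets in a partition, and we apply the identities (4.3) with localizations at the points x, x₃ fixed"*,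
with the factor `exp(−κd_j(X) − δ₀dist^{(ξ)}(X, x) − δ₀dist^{(ξ)}(X, x₃))`): when two localised arguments lie in
DIFFERENT blocks `p₀ ≠ p₁`, both localisation weights survive — `‖term‖ ≤ S (2rB₃/α₂)^r · w_{p₀} w_{p₁} · Π_i |B_i|`
— by the same Cauchy estimate; each weight is the p. 282 input for its own block ((190) of [15] if `n(p) = 1`,
`loc_dH_le_of_ineq190_localised`; the Sect. G tree-graph decay if `n(p) ≥ 2`, not typed).  Two localised arguments
in the SAME block (p. 286, first case: *"the exponential factor, with a length of a shortest tree graph in the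
exponent, yields the factor exp(−δ₀|x₃ − x|)"*) are NOT covered by this lemma: that is the intra-block tree decay of
[15] Sect. G for `n(p) ≥ 2` (cell GAPS G-B11-G2a). [cite: Balaban1987RG1, p.286 before (4.22); (4.3) p.281] -/
theorem term_bound_pair {U : Set E} (hU : IsOpen U) {α₂ S B₃ : ℝ} (hα : 0 < α₂) (hball : ball (0 : E) α₂ ⊆ U)
    {f : E → F} (hf : DifferentiableOn ℂ f U) (hS : ∀ y ∈ ball (0 : E) α₂, ‖f y‖ ≤ S) (hB₃ : 0 ≤ B₃)
    {r : ℕ} (N : Fin r → Finset ι) (hdisj : ∀ p q, p ≠ q → Disjoint (N p) (N q))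
    (hcov : Finset.univ.biUnion N = Finset.univ) (b : ι → ℝ) (hb : ∀ i, 0 ≤ b i)
    (w : Fin r → ℝ) (hw0 : ∀ p, 0 ≤ w p) (hw1 : ∀ p, w p ≤ 1)
    (v : Fin r → E) (hv : ∀ p, ‖v p‖ ≤ w p * (B₃ * ∏ i ∈ N p, b i)) {p₀ p₁ : Fin r} (hne : p₀ ≠ p₁) :
    ‖dirIter r v f 0‖ ≤ S * (2 * r * B₃ / α₂) ^ r * (w p₀ * w p₁) * ∏ i, b i := by
  have hS0 : 0 ≤ S := (norm_nonneg _).trans (hS 0 (mem_ball_self hα))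
  set β : Fin r → ℝ := fun p => w p * (B₃ * ∏ i ∈ N p, b i) with hβdef
  have hβ : ∀ p, 0 ≤ β p := fun p =>
    mul_nonneg (hw0 p) (mul_nonneg hB₃ (Finset.prod_nonneg fun i _ => hb i))
  have h1 := norm_dirIter_le_of_ball' hU hα hball hf hS v β hβ hv
  have h2 : ∏ p, β p = (∏ p, w p) * (B₃ ^ r * ∏ i, b i) := by
    simp only [hβdef]
    rw [Finset.prod_mul_distrib, Finset.prod_mul_distrib, Finset.prod_const, Finset.card_univ,
      Fintype.card_fin, prod_blocks_eq N hdisj hcov b]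
  have hP : 0 ≤ B₃ ^ r * ∏ i, b i := mul_nonneg (pow_nonneg hB₃ _) (Finset.prod_nonneg fun i _ => hb i)
  have h3 : (∏ p, w p) * (B₃ ^ r * ∏ i, b i) ≤ (w p₀ * w p₁) * (B₃ ^ r * ∏ i, b i) :=
    mul_le_mul_of_nonneg_right (prod_weights_le_pair w hw0 hw1 hne) hP
  have h4 : (2 * (r : ℝ) * B₃ / α₂) ^ r = (2 * r / α₂) ^ r * B₃ ^ r := by
    rw [← mul_pow]; congr 1; ring
  calc ‖dirIter r v f 0‖ ≤ S * (2 * r / α₂) ^ r * ∏ p, β p := h1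
    _ = S * (2 * r / α₂) ^ r * ((∏ p, w p) * (B₃ ^ r * ∏ i, b i)) := by rw [h2]
    _ ≤ S * (2 * r / α₂) ^ r * ((w p₀ * w p₁) * (B₃ ^ r * ∏ i, b i)) :=
      mul_le_mul_of_nonneg_left h3 (mul_nonneg hS0 (pow_nonneg (by positivity) _))
    _ = S * (2 * r * B₃ / α₂) ^ r * (w p₀ * w p₁) * ∏ i, b i := by rw [h4]; ring

end Blocks

/-! ## The number of terms of (4.3): set partitions of an `n`-set number at most `nⁿ` -/

section Count

variable {ι : Type*} [Fintype ι] [DecidableEq ι] [LinearOrder ι]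

/-- The label of `i` in the partition `P`: the least element of its block. [folklore] -/
def label (P : Finpartition (Finset.univ : Finset ι)) (i : ι) : ι :=
  (P.part i).min' (P.part_nonempty.2 (Finset.mem_univ i))

/-- The label of an index lies in its block. [folklore] -/
theorem label_mem (P : Finpartition (Finset.univ : Finset ι)) (i : ι) : label P i ∈ P.part i :=
  Finset.min'_mem _ _

/-- Two indices lie in the same block iff they carry the same label. [folklore] -/
theorem mem_part_iff_label_eq (P : Finpartition (Finset.univ : Finset ι)) (i j : ι) :
    j ∈ P.part i ↔ label P j = label P i := by
  constructor
  · intro h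
    have hji : P.part j = P.part i :=
      (P.mem_part_iff_part_eq_part (Finset.mem_univ j) (Finset.mem_univ i)).1 h
    apply le_antisymm
    · have hm : label P i ∈ P.part j := hji ▸ label_mem P i
      exact Finset.min'_le _ _ hm
    · have hm : label P j ∈ P.part i := hji ▸ label_mem P j
      exact Finset.min'_le _ _ hm
  · intro h
    have hj : label P j ∈ P.part j := label_mem P j
    have hi : label P i ∈ P.part i := label_mem P i
    rw [h] at hj
    have heq : P.part j = P.part i :=
      P.eq_of_mem_parts (P.part_mem.2 (Finset.mem_univ j)) (P.part_mem.2 (Finset.mem_univ i)) hj hi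
    exact heq ▸ P.mem_part (Finset.mem_univ j)

/-- A set partition is determined by its label function. [folklore] -/
theorem label_injective : Function.Injective (label (ι := ι)) := by
  intro P Q h
  have hparts : ∀ i, P.part i = Q.part i := by
    intro i; ext j
    rw [mem_part_iff_label_eq, mem_part_iff_label_eq, h]
  ext t
  constructor
  · intro ht
    obtain ⟨a, ha, hat⟩ := P.part_surjOn ht
    rw [← hat, hparts a]
    exact Q.part_mem.2 ha
  · intro ht
    obtain ⟨a, ha, hat⟩ := Q.part_surjOn ht
    rw [← hat, ← hparts a]
    exact P.part_mem.2 ha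

/-- **Bell(n) ≤ nⁿ**: the set partitions of a finite linearly ordered index set `ι` inject into the functions
`ι → ι` (index ↦ least element of its block), so any finite family of them has at most `|ι|^|ι|` members. [folklore] -/
theorem card_finpartitions_le (fam : Finset (Finpartition (Finset.univ : Finset ι))) :
    fam.card ≤ Fintype.card ι ^ Fintype.card ι := by
  calc fam.card ≤ (Finset.univ : Finset (ι → ι)).card :=
        Finset.card_le_card_of_injOn label (fun _ _ => Finset.mem_univ _) (label_injective.injOn)
    _ = Fintype.card ι ^ Fintype.card ι := by rw [Finset.card_univ, Fintype.card_fun]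

end Count

/-! ## (4.5): the sum over the terms of (4.3) -/

section Sum

variable {F : Type*} [NormedAddCommGroup F]

/-- **The arithmetic of the constant `(2n²B₃α₂⁻¹)ⁿ` of (4.5).**  A finite family of terms (the set partitions
`{1,…,n} = N(1) ∪ … ∪ N(r)` of (4.3)), at most `nⁿ` of them, the term with `r ∈ [1, n]` blocks bounded by
`S (2rB₃/α₂)^r · W · P` (`term_bound`; `W` = the one localisation factor, `P = Π_i |B_i|`): if `2B₃ ≥ α₂ > 0` the sum
is at most `(2n²B₃/α₂)ⁿ · S · W · P` — the right-hand side of (4.5) with `S = E₀ exp(−κd_j(X))`,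
`W = exp(−δ₀ dist^{(ξ)}(X, supp(1−ζ̃_□)))`, `P = |ζ̃_□B|^m |(1−ζ̃_□)B|^{n−m}`. [cite: Balaban1987RG1, (4.5) p.282] -/
theorem sum_bound {T : Type*} (s : Finset T) (n : ℕ) (hT : s.card ≤ n ^ n) (blocks : T → ℕ)
    (hb1 : ∀ t ∈ s, 1 ≤ blocks t) (hbn : ∀ t ∈ s, blocks t ≤ n)
    {S B₃ α₂ W P : ℝ} (hS : 0 ≤ S) (hα : 0 < α₂) (hB : α₂ ≤ 2 * B₃) (hW : 0 ≤ W) (hP : 0 ≤ P)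
    (term : T → F)
    (hterm : ∀ t ∈ s, ‖term t‖ ≤ S * (2 * (blocks t : ℝ) * B₃ / α₂) ^ blocks t * W * P) :
    ‖∑ t ∈ s, term t‖ ≤ (2 * (n : ℝ) ^ 2 * B₃ / α₂) ^ n * S * W * P := by
  have hB₃ : 0 ≤ B₃ := by linarith
  have hx1 : 1 ≤ 2 * B₃ / α₂ := by rw [le_div_iff₀ hα]; linarith
  set C : ℝ := S * (2 * (n : ℝ) * B₃ / α₂) ^ n * W * P with hCdef
  have hC : 0 ≤ C := by positivity
  have hterm' : ∀ t ∈ s, ‖term t‖ ≤ C := by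
    intro t ht
    have hr1 : (1 : ℝ) ≤ blocks t := by exact_mod_cast hb1 t ht
    have hrn : (blocks t : ℝ) ≤ n := by exact_mod_cast hbn t ht
    have hn1 : (1 : ℝ) ≤ n := hr1.trans hrn
    have hxr : (2 * (blocks t : ℝ) * B₃ / α₂) ^ blocks t ≤ (2 * (n : ℝ) * B₃ / α₂) ^ n :=
      calc (2 * (blocks t : ℝ) * B₃ / α₂) ^ blocks t ≤ (2 * (n : ℝ) * B₃ / α₂) ^ blocks t := by
            apply pow_le_pow_left₀ (by positivity)
            rw [mul_assoc, mul_assoc, mul_comm 2, mul_comm 2, mul_assoc, mul_assoc]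
            exact div_le_div_of_nonneg_right (mul_le_mul_of_nonneg_right hrn (by positivity)) hα.le
        _ ≤ (2 * (n : ℝ) * B₃ / α₂) ^ n := by
            apply pow_le_pow_right₀ ?_ (hbn t ht)
            calc (1 : ℝ) = 1 * 1 := by ring
              _ ≤ n * (2 * B₃ / α₂) := mul_le_mul hn1 hx1 zero_le_one (by positivity)
              _ = 2 * n * B₃ / α₂ := by ring
    calc ‖term t‖ ≤ S * (2 * (blocks t : ℝ) * B₃ / α₂) ^ blocks t * W * P := hterm t ht
      _ ≤ S * (2 * (n : ℝ) * B₃ / α₂) ^ n * W * P := by gcongr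
  calc ‖∑ t ∈ s, term t‖ ≤ ∑ t ∈ s, ‖term t‖ := norm_sum_le _ _
    _ ≤ ∑ _t ∈ s, C := Finset.sum_le_sum hterm'
    _ = s.card * C := by rw [Finset.sum_const, nsmul_eq_mul]
    _ ≤ (n : ℝ) ^ n * C := mul_le_mul_of_nonneg_right (by exact_mod_cast hT) hC
    _ = (2 * (n : ℝ) ^ 2 * B₃ / α₂) ^ n * S * W * P := by
        rw [hCdef, show (2 * (n : ℝ) ^ 2 * B₃ / α₂) = n * (2 * n * B₃ / α₂) by ring, mul_pow]; ring

/-- The same over the ACTUAL index set of (4.3) — the set partitions of `{1, …, n}` (`Finpartition univ` of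
`Fin n`), `blocks P = #P.parts = r` — using `card_finpartition_le` (Bell(n) ≤ nⁿ); `n ≥ 1`.
[cite: Balaban1987RG1, (4.3), (4.5) pp.281–282] -/
theorem sum_bound_partitions (n : ℕ) (hn : 1 ≤ n) {S B₃ α₂ W P : ℝ} (hS : 0 ≤ S) (hα : 0 < α₂)
    (hB : α₂ ≤ 2 * B₃) (hW : 0 ≤ W) (hP : 0 ≤ P)
    (term : Finpartition (Finset.univ : Finset (Fin n)) → F)
    (hterm : ∀ Q, ‖term Q‖ ≤ S * (2 * (Q.parts.card : ℝ) * B₃ / α₂) ^ Q.parts.card * W * P) :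
    ‖∑ Q, term Q‖ ≤ (2 * (n : ℝ) ^ 2 * B₃ / α₂) ^ n * S * W * P := by
  have hcount : (Finset.univ : Finset (Finpartition (Finset.univ : Finset (Fin n)))).card ≤ n ^ n := by
    simpa using card_finpartitions_le (ι := Fin n) Finset.univ
  have hne : (Finset.univ : Finset (Fin n)) ≠ ⊥ := by
    rw [Finset.bot_eq_empty, ← Finset.nonempty_iff_ne_empty]
    exact ⟨⟨0, hn⟩, Finset.mem_univ _⟩
  have hb1 : ∀ Q ∈ (Finset.univ : Finset (Finpartition (Finset.univ : Finset (Fin n)))),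
      1 ≤ Q.parts.card := fun Q _ => (Q.parts_nonempty hne).card_pos
  have hbn : ∀ Q ∈ (Finset.univ : Finset (Finpartition (Finset.univ : Finset (Fin n)))),
      Q.parts.card ≤ n := fun Q _ => by simpa using Q.card_parts_le_card
  exact sum_bound (T := Finpartition (Finset.univ : Finset (Fin n))) Finset.univ n hcount
    (fun Q => Q.parts.card) hb1 hbn hS hα hB hW hP term fun Q _ => hterm Q

end Sum

/-! ## The p. 282 input for blocks with `n(p) = 1`, from [15] Sect. G (190) (tree `B11SectG.Ineq190`)

For a block `N(p) = {i}` the direction is `v_p = (δ/δB)𝐇_j(□₀,0) B_i = dH B_i`, and the p. 282 sentence asserts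
`‖dH B_i‖ ≤ B₃ |B_i|`, with the extra factor `exp(−δ₀ dist(X, supp B_i))` when `B_i` is localised outside `X`.  In
the block-majorant vocabulary of `B11SectG` ((190) = `HasMaj bB bout dH (C e^{−⅛δ₀ d(y,y′)})`, one entry of (190)
per local size `bout`) this follows from `HasMaj.bound` (the partition of unity of the B-space) and ONE row sum of
Lemma 2.1 [3] (`B11SectG.RowSum`), and the kernel makes the constants of cell GAPS G-IF-06 explicit:
`B₃ = C · κ_B · c(σ)` and the B12 rate is `τ = ⅛δ₀^{[15]} − σ` for the row-sum margin `σ > 0` — STRICTLY below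
`⅛δ₀^{[15]}` (a `D`-uniform constant at the full rate is impossible: `Σ_{d(y,y′) ≥ D} e^{−⅛δ₀d(y,y′)}` grows
polynomially in `D` relative to `e^{−⅛δ₀D}`).  The higher blocks `n(p) ≥ 2` (tree graphs of Sect. G) are NOT typed in
`B11SectG` (cell GAPS G-B11-G2a) and stay the named hypothesis `hv` of `term_bound`. -/

section FromB11

open B11SectG

variable {g : B6.Geometry} {FB FA : Type} [AddCommGroup FB] [Module ℝ FB] [AddCommGroup FA] [Module ℝ FA]

/-- **`n(p) = 1`, no localisation**: (190) + the row sum at any rate `σ ≤ ⅛δ₀` ⇒ `loc_y(dH B) ≤ C κ_B c · |B|` for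
every block `y`, `|B| = sup_{y′} loc_{y′} B`. [cite: Balaban1987RG1, p.282; Balaban1985Variational, (190) p.308;
Balaban1984PropagatorsII, Lemma 2.1 (2.61) p.234] -/
theorem loc_dH_le_of_ineq190 {bB : BlockNorm g FB} {bout : BlockNorm g FA} {dH : FB →ₗ[ℝ] FA}
    {C δ₀ σ c m : ℝ} (h190 : Ineq190 bB bout dH C δ₀) (hC : 0 ≤ C) (hd : ∀ a b : g.Site, 0 ≤ g.dist a b)
    (hrow : RowSum g σ c) (hσ : σ ≤ δ₀ / 8) (B : FB) (hm : ∀ y', bB.loc y' B ≤ m) (y : g.Site) :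
    bout.loc y (dH B) ≤ C * bB.κ * c * m := by
  have hK : ∀ a b : g.Site, 0 ≤ C * Real.exp (-(δ₀ / 8 * g.dist a b)) :=
    fun a b => mul_nonneg hC (Real.exp_nonneg _)
  have hm0 : 0 ≤ m := (bB.loc_nonneg y B).trans (hm y)
  have hκm : 0 ≤ C * bB.κ * m := mul_nonneg (mul_nonneg hC bB.κ_nonneg) hm0
  calc bout.loc y (dH B)
      ≤ ∑ y', C * Real.exp (-(δ₀ / 8 * g.dist y y')) * (bB.κ * bB.loc y' B) := HasMaj.bound h190 hK B y
    _ ≤ ∑ y', C * Real.exp (-(σ * g.dist y y')) * (bB.κ * m) := by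
        refine Finset.sum_le_sum fun y' _ => ?_
        have he : Real.exp (-(δ₀ / 8 * g.dist y y')) ≤ Real.exp (-(σ * g.dist y y')) :=
          Real.exp_le_exp.mpr (by nlinarith [hd y y'])
        have hκ : 0 ≤ bB.κ * bB.loc y' B := mul_nonneg bB.κ_nonneg (bB.loc_nonneg _ _)
        calc C * Real.exp (-(δ₀ / 8 * g.dist y y')) * (bB.κ * bB.loc y' B)
            ≤ C * Real.exp (-(σ * g.dist y y')) * (bB.κ * bB.loc y' B) :=
              mul_le_mul_of_nonneg_right (mul_le_mul_of_nonneg_left he hC) hκ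
          _ ≤ C * Real.exp (-(σ * g.dist y y')) * (bB.κ * m) :=
              mul_le_mul_of_nonneg_left (mul_le_mul_of_nonneg_left (hm y') bB.κ_nonneg)
                (mul_nonneg hC (Real.exp_nonneg _))
    _ = C * bB.κ * m * ∑ y', Real.exp (-(σ * g.dist y y')) := by
        rw [Finset.mul_sum]
        exact Finset.sum_congr rfl fun y' _ => by ring
    _ ≤ C * bB.κ * m * c := mul_le_mul_of_nonneg_left (hrow y) hκm
    _ = C * bB.κ * c * m := by ring

/-- **`n(p) = 1`, localised outside `X`**: if the block sizes of `B` vanish on every block `y′` closer than `D` to a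
block `y ∈ X` (*"B_i is localized outside the domain X"*, `D = dist(X, supp B_i)`), then for `y ∈ X`,
`loc_y(dH B) ≤ C κ_B c · |B| · e^{−τD}` for every rate `τ ≥ 0` with `τ + σ ≤ ⅛δ₀`, `σ` the rate of the row sum used:
the *"additional exponential factor exp(−δ₀ dist(X, supp B_i))"* of p. 282 with `δ₀^{[I]} = τ < ⅛δ₀^{[15]}` (cell
GAPS G-IF-06 made explicit). [cite: Balaban1987RG1, p.282; Balaban1985Variational, (190) p.308;
Balaban1984PropagatorsII, Lemma 2.1 (2.61) p.234] -/
theorem loc_dH_le_of_ineq190_localised {bB : BlockNorm g FB} {bout : BlockNorm g FA} {dH : FB →ₗ[ℝ] FA}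
    {C δ₀ σ τ c m D : ℝ} (h190 : Ineq190 bB bout dH C δ₀) (hC : 0 ≤ C)
    (hd : ∀ a b : g.Site, 0 ≤ g.dist a b) (hrow : RowSum g σ c) (hτ : 0 ≤ τ) (hστ : σ + τ ≤ δ₀ / 8)
    (B : FB) (hm : ∀ y', bB.loc y' B ≤ m) (X : Set g.Site)
    (hD : ∀ y ∈ X, ∀ y', bB.loc y' B ≠ 0 → D ≤ g.dist y y') {y : g.Site} (hy : y ∈ X) :
    bout.loc y (dH B) ≤ C * bB.κ * c * m * Real.exp (-(τ * D)) := by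
  have hK : ∀ a b : g.Site, 0 ≤ C * Real.exp (-(δ₀ / 8 * g.dist a b)) :=
    fun a b => mul_nonneg hC (Real.exp_nonneg _)
  have hm0 : 0 ≤ m := (bB.loc_nonneg y B).trans (hm y)
  have hκm : 0 ≤ C * bB.κ * m * Real.exp (-(τ * D)) :=
    mul_nonneg (mul_nonneg (mul_nonneg hC bB.κ_nonneg) hm0) (Real.exp_nonneg _)
  have hterm : ∀ y', C * Real.exp (-(δ₀ / 8 * g.dist y y')) * (bB.κ * bB.loc y' B) ≤
      C * Real.exp (-(τ * D)) * Real.exp (-(σ * g.dist y y')) * (bB.κ * m) := by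
    intro y'
    by_cases hz : bB.loc y' B = 0
    · rw [hz, mul_zero, mul_zero]
      exact mul_nonneg (mul_nonneg (mul_nonneg hC (Real.exp_nonneg _)) (Real.exp_nonneg _))
        (mul_nonneg bB.κ_nonneg hm0)
    · have hDd : D ≤ g.dist y y' := hD y hy y' hz
      have he : Real.exp (-(δ₀ / 8 * g.dist y y')) ≤
          Real.exp (-(τ * D)) * Real.exp (-(σ * g.dist y y')) := by
        rw [← Real.exp_add]
        refine Real.exp_le_exp.mpr ?_
        have h1 : τ * D ≤ τ * g.dist y y' := mul_le_mul_of_nonneg_left hDd hτ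
        have h2 : (σ + τ) * g.dist y y' ≤ δ₀ / 8 * g.dist y y' :=
          mul_le_mul_of_nonneg_right hστ (hd y y')
        nlinarith
      have hκ : 0 ≤ bB.κ * bB.loc y' B := mul_nonneg bB.κ_nonneg (bB.loc_nonneg _ _)
      calc C * Real.exp (-(δ₀ / 8 * g.dist y y')) * (bB.κ * bB.loc y' B)
          ≤ C * (Real.exp (-(τ * D)) * Real.exp (-(σ * g.dist y y'))) * (bB.κ * bB.loc y' B) :=
            mul_le_mul_of_nonneg_right (mul_le_mul_of_nonneg_left he hC) hκ
        _ ≤ C * (Real.exp (-(τ * D)) * Real.exp (-(σ * g.dist y y'))) * (bB.κ * m) :=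
            mul_le_mul_of_nonneg_left (mul_le_mul_of_nonneg_left (hm y') bB.κ_nonneg)
              (mul_nonneg hC (mul_nonneg (Real.exp_nonneg _) (Real.exp_nonneg _)))
        _ = C * Real.exp (-(τ * D)) * Real.exp (-(σ * g.dist y y')) * (bB.κ * m) := by ring
  calc bout.loc y (dH B)
      ≤ ∑ y', C * Real.exp (-(δ₀ / 8 * g.dist y y')) * (bB.κ * bB.loc y' B) := HasMaj.bound h190 hK B y
    _ ≤ ∑ y', C * Real.exp (-(τ * D)) * Real.exp (-(σ * g.dist y y')) * (bB.κ * m) :=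
        Finset.sum_le_sum fun y' _ => hterm y'
    _ = C * bB.κ * m * Real.exp (-(τ * D)) * ∑ y', Real.exp (-(σ * g.dist y y')) := by
        rw [Finset.mul_sum]
        exact Finset.sum_congr rfl fun y' _ => by ring
    _ ≤ C * bB.κ * m * Real.exp (-(τ * D)) * c := mul_le_mul_of_nonneg_left (hrow y) hκm
    _ = C * bB.κ * c * m * Real.exp (-(τ * D)) := by ring

end FromB11

/-! ## (4.5) as printed, and its assembly from (4.3) -/

section Display

variable {F : Type*} [NormedAddCommGroup F]

/-- The numbers printed in (4.5) (B12 p. 282 [34]): `n`, `m` with `m < n` (the printed range), the modulus `lhs` of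
the pairing `⟨δⁿ/δBⁿ 𝐄^{(j)}(X, U_j(□₀,1)), (⊗^m ζ̃_□B) ⊗ (⊗^{n−m} (1−ζ̃_□)B)⟩`, the constants `B₃` (p. 282, from
[15] Sect. G), `α₂` ((4.4)), `E₀`, `κ`, `d_j(X)` ((1.18)), `δ₀` and `dist^{(ξ)}(X, supp(1−ζ̃_□))`, and the norms
`|ζ̃_□B|`, `|(1−ζ̃_□)B|`. [cite: Balaban1987RG1, (4.5) p.282] -/
structure Data45 where
  n : ℕ
  m : ℕ
  /-- *"Terms with m < n are exponentially small in L^jη"*, *"Consider a term in (4.1) with m < n"* (pp. 281–282):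
  the display (4.5) is printed for `m < n` only (so `n − m ≥ 1` and `n ≥ 1`). -/
  m_lt_n : m < n
  lhs : ℝ
  B₃ : ℝ
  α₂ : ℝ
  E₀ : ℝ
  κ : ℝ
  djX : ℝ
  δ₀ : ℝ
  distX : ℝ
  normZB : ℝ
  normCZB : ℝ

/-- **(4.5)** (p. 282 [34], verbatim): *"|⟨δⁿ/δBⁿ 𝐄^{(j)}(X, U_j(□₀, 1)), (⊗^m ζ̃_□B) ⊗ (⊗^{n−m} (1−ζ̃_□)B)⟩|
≤ (2n²B₃ (1/α₂))ⁿ E₀ exp(−κd_j(X)) exp(−δ₀ dist^{(ξ)}(X, supp(1−ζ̃_□))) × |ζ̃_□B|^m |(1−ζ̃_□)B|^{n−m}.  (4.5)"*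
— typed display-shape over `Data45`; nothing of it is asserted. [cite: Balaban1987RG1, (4.5) p.282] -/
def Ineq45Printed (D : Data45) : Prop :=
  D.lhs ≤ (2 * (D.n : ℝ) ^ 2 * D.B₃ * (1 / D.α₂)) ^ D.n * D.E₀ * Real.exp (-(D.κ * D.djX)) *
    Real.exp (-(D.δ₀ * D.distX)) * (D.normZB ^ D.m * D.normCZB ^ (D.n - D.m))

/-- The sizes of the `n` arguments of (4.5): `m` copies of `|ζ̃_□B|`, then `n − m` copies of `|(1−ζ̃_□)B|`; their
product is `|ζ̃_□B|^m |(1−ζ̃_□)B|^{n−m}`. [folklore] -/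
theorem prod_two_kinds {n m : ℕ} (hm : m ≤ n) (z cz : ℝ) :
    ∏ i : Fin n, (if (i : ℕ) < m then z else cz) = z ^ m * cz ^ (n - m) := by
  have hc : (Finset.univ.filter fun i : Fin n => (i : ℕ) < m).card = m := by
    rw [Fin.card_filter_val_lt, min_eq_right hm]
  rw [Finset.prod_ite, Finset.prod_const, Finset.prod_const, hc]
  congr 2
  have h := Finset.card_filter_add_card_filter_not (s := (Finset.univ : Finset (Fin n)))
    (fun i : Fin n => (i : ℕ) < m)
  rw [hc, Finset.card_univ, Fintype.card_fin] at h
  omega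

/-- **(4.3) + (4.4) + (1.18) + the p. 282 sentence ⇒ (4.5).**  Hypotheses, all by name: the left-hand side of (4.5)
is the modulus of the sum (4.3) over the set partitions `Q` of `{1,…,n}` of terms `term Q` (the `r`-fold
`τ`-derivatives at `0`, `r = #Q.parts`), each obeying the bound of `term_bound` with `S = E₀ exp(−κd_j(X))` (the sup
(1.18) of `A ↦ 𝐄^{(j)}(X, exp iξA)` on the domain (4.4)), the one localisation factor `W = exp(−δ₀ dist^{(ξ)}(X,
supp(1−ζ̃_□)))` (a block containing one of the `n − m ≥ 1` arguments `(1−ζ̃_□)B`), and `P = |ζ̃_□B|^m |(1−ζ̃_□)B|^{n−m}`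
(`prod_two_kinds`); and the harmless normalisation `2B₃ ≥ α₂` of the constant of [15] Sect. G.  Conclusion: the
display (4.5) — its constant `(2n²B₃α₂⁻¹)ⁿ` is (number of partitions ≤ nⁿ, `card_finpartitions_le`) × (the Cauchy
radii `α₂/(2rβ_p)`, `(2rB₃/α₂)^r ≤ (2nB₃/α₂)ⁿ`). [cite: Balaban1987RG1, (4.3)–(4.5) pp.281–282, (1.18) p.263] -/
theorem ineq45_of_repr43 (D : Data45) (hE₀ : 0 ≤ D.E₀) (hα : 0 < D.α₂)
    (hB : D.α₂ ≤ 2 * D.B₃) (hz : 0 ≤ D.normZB) (hcz : 0 ≤ D.normCZB)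
    (term : Finpartition (Finset.univ : Finset (Fin D.n)) → F) (hlhs : D.lhs = ‖∑ Q, term Q‖)
    (hterm : ∀ Q, ‖term Q‖ ≤ D.E₀ * Real.exp (-(D.κ * D.djX)) *
      (2 * (Q.parts.card : ℝ) * D.B₃ / D.α₂) ^ Q.parts.card * Real.exp (-(D.δ₀ * D.distX)) *
      (D.normZB ^ D.m * D.normCZB ^ (D.n - D.m))) :
    Ineq45Printed D := by
  have hn : 1 ≤ D.n := Nat.one_le_of_lt D.m_lt_n
  unfold Ineq45Printed
  rw [hlhs]
  have h := sum_bound_partitions D.n hn (S := D.E₀ * Real.exp (-(D.κ * D.djX)))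
    (B₃ := D.B₃) (α₂ := D.α₂) (W := Real.exp (-(D.δ₀ * D.distX)))
    (P := D.normZB ^ D.m * D.normCZB ^ (D.n - D.m))
    (mul_nonneg hE₀ (Real.exp_nonneg _)) hα hB (Real.exp_nonneg _)
    (mul_nonneg (pow_nonneg hz _) (pow_nonneg hcz _)) term hterm
  refine h.trans (le_of_eq ?_)
  rw [one_div, ← div_eq_mul_inv]
  ring

end Display

end Literature.MathematicalPhysics.QuantumFieldTheory.Balaban1983to89.B12Ineq45
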